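import Mathlib.Analysis.Calculus.MeanValue
import Mathlib.Analysis.Calculus.InverseFunctionTheorem.FDeriv
import Mathlib.Analysis.Calculus.ContDiff.RCLike
import Mathlib.Analysis.Calculus.ContDiff.Operations
import Mathlib.Analysis.Normed.Module.FiniteDimension
import Mathlib.Topology.Algebra.Module.FiniteDimension
import HarnessLib

/-!
# Local injectivity and openness of fibrewise affine tube maps

The two pieces of differential calculus behind the tubular neighbourhood theorem for manifolds
WITH BOUNDARY (Hirsch, *Differential Topology* (1976), Ch. 4, Thm. 5.1 and §6; Kosinski,
*Differential Manifolds* (1993), III.2): for the tube map of an immersion `f` with normal fields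
`νᵢ`, written in a chart whose image `C` is only a convex set (a half ball for a boundary chart),

  `tubeMap f ν (x, s) = f x + ∑ᵢ sᵢ • νᵢ x`,

* `injOn_of_hasFDerivWithinAt_of_antilipschitz` — **a `C¹` map on a convex set whose derivative at
  `p₀` is bounded below is injective near `p₀`** (mean value inequality
  `Convex.norm_image_sub_le_of_norm_hasFDerivWithin_le'`); no interior is needed, so it applies at
  boundary points of half-space charts;
* `hasFDerivWithinAt_tubeMap`, `continuousOn_tubeMapDeriv` — the derivative of the tube map within
  `C ×ˢ univ` and its continuity, from `ContDiffOn ℝ 1` data on `C`;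
* **`exists_injOn_tubeMap`** — if `(v, σ) ↦ f′(x₀) v + ∑ σᵢ νᵢ(x₀)` is bounded below (transversality
  of the frame) then `tubeMap f ν` is injective on `(C ∩ B(x₀, r)) × B(0, r)` for some `r > 0`;
* **`map_nhds_tubeMap_eq`** — at a point `x` with `C ∈ 𝓝 x` (an interior point) and `s` where the
  full derivative `(v, σ) ↦ f′(x) v + ∑ sᵢ νᵢ′(x) v + ∑ σᵢ νᵢ(x)` is injective (equal finite
  dimensions), the tube map is open at `(x, s)` (inverse function theorem,
  `HasStrictFDerivAt.map_nhds_eq_of_equiv`).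

Pure normed-space calculus over `ℝ`; everything is proved, no named facts.

## References

* M. W. Hirsch, *Differential Topology*, GTM 33, Springer 1976, Ch. 4 Thm. 5.1, §6 (tubular
  neighbourhoods, also for ∂-manifolds). [Hirsch1976]
* A. Kosinski, *Differential Manifolds*, Academic Press 1993, III.2. [Kosinski1993]
-/

noncomputable section

open Set Filter Metric Topology
open scoped NNReal

namespace Literature.Topology.FourManifolds

namespace AffineTube

variable {P Q : Type*} [NormedAddCommGroup P] [NormedSpace ℝ P] [NormedAddCommGroup Q]
  [NormedSpace ℝ Q]

/-! ### A `C¹` map with derivative bounded below is locally injective on a convex set -/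

/-- **Local injectivity from a derivative bounded below, on a convex set** (Hirsch 1976, Ch. 2 §1
Ex. 7 / Ch. 4 proof of Thm. 5.1, in the form valid up to the boundary): if `G` has derivative `G′`
within the convex set `K` at every point of `K`, `G′` is continuous within `K` at `p₀`, and
`c ‖v‖ ≤ ‖G′(p₀) v‖` with `c > 0`, then `G` is injective on `K ∩ B(p₀, r)` for some `r > 0`.
[cite: Hirsch1976, Ch. 4 Thm. 5.1] -/
theorem injOn_of_hasFDerivWithinAt_of_antilipschitz {K : Set P} (hK : Convex ℝ K) {p₀ : P}
    {G : P → Q} {G' : P → P →L[ℝ] Q}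
    (hG : ∀ p ∈ K, HasFDerivWithinAt G (G' p) K p) (hcont : ContinuousWithinAt G' K p₀)
    {c : ℝ} (hc : 0 < c) (hbelow : ∀ v, c * ‖v‖ ≤ ‖G' p₀ v‖) :
    ∃ r > 0, InjOn G (K ∩ ball p₀ r) := by
  -- continuity of the derivative: `‖G' p - G' p₀‖ ≤ c / 2` near `p₀`
  have hev : ∀ᶠ p in 𝓝[K] p₀, ‖G' p - G' p₀‖ < c / 2 := by
    have hc' : ContinuousWithinAt (fun p => ‖G' p - G' p₀‖) K p₀ :=
      (hcont.sub (continuousWithinAt_const (b := G' p₀))).norm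
    have h0 : ‖G' p₀ - G' p₀‖ < c / 2 := by rw [sub_self, norm_zero]; linarith
    exact hc'.eventually (gt_mem_nhds h0)
  obtain ⟨r, hr, hball⟩ : ∃ r > 0, ∀ p ∈ K, p ∈ ball p₀ r → ‖G' p - G' p₀‖ < c / 2 := by
    rcases Metric.mem_nhdsWithin_iff.1 hev with ⟨r, hr, h⟩
    exact ⟨r, hr, fun p hpK hpr => h ⟨hpr, hpK⟩⟩
  refine ⟨r, hr, fun x ⟨hxK, hxr⟩ y ⟨hyK, hyr⟩ hxy => ?_⟩
  have hconv : Convex ℝ (K ∩ ball p₀ r) := hK.inter (convex_ball p₀ r)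
  have hderiv : ∀ p ∈ K ∩ ball p₀ r, HasFDerivWithinAt G (G' p) (K ∩ ball p₀ r) p :=
    fun p hp => (hG p hp.1).mono inter_subset_left
  have hbound : ∀ p ∈ K ∩ ball p₀ r, ‖G' p - G' p₀‖ ≤ c / 2 :=
    fun p hp => (hball p hp.1 hp.2).le
  have key := hconv.norm_image_sub_le_of_norm_hasFDerivWithin_le' hderiv hbound
    ⟨hxK, hxr⟩ ⟨hyK, hyr⟩
  rw [hxy, sub_self, zero_sub, norm_neg] at key
  have h1 := hbelow (y - x)
  by_contra hne
  have hpos : 0 < ‖y - x‖ := norm_pos_iff.2 (sub_ne_zero.2 (Ne.symm hne))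
  nlinarith

/-! ### The tube map and its derivative -/

variable {ι : Type*} [Fintype ι]

/-- **The fibrewise affine tube map** `(x, s) ↦ f x + ∑ᵢ sᵢ • νᵢ x` of a map `f` with fields
`νᵢ` (Hirsch 1976, Ch. 4 §5: the map `(x, v) ↦ "x + v"` on the normal bundle, in a framing).
[cite: Hirsch1976, Ch. 4 Thm. 5.1] -/
def tubeMap (f : P → Q) (ν : ι → P → Q) (p : P × (ι → ℝ)) : Q :=
  f p.1 + ∑ i, p.2 i • ν i p.1

omit [NormedAddCommGroup P] [NormedSpace ℝ P] in
/-- `tubeMap f ν (x, 0) = f x`. [folklore] -/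
@[simp] lemma tubeMap_zero (f : P → Q) (ν : ι → P → Q) (x : P) : tubeMap f ν (x, 0) = f x := by
  simp [tubeMap]

/-- The derivative of the tube map at `(x, s)` for given derivatives `f′`, `νᵢ′`:
`(v, σ) ↦ f′ v + ∑ᵢ (σᵢ • νᵢ x + sᵢ • νᵢ′ v)`. [folklore] -/
def tubeMapDeriv (ν : ι → P → Q) (f' : P →L[ℝ] Q) (ν' : ι → P →L[ℝ] Q) (x : P) (s : ι → ℝ) :
    P × (ι → ℝ) →L[ℝ] Q :=
  f'.comp (ContinuousLinearMap.fst ℝ P (ι → ℝ)) +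
    ∑ i, (s i • (ν' i).comp (ContinuousLinearMap.fst ℝ P (ι → ℝ)) +
      ((ContinuousLinearMap.proj i).comp (ContinuousLinearMap.snd ℝ P (ι → ℝ))).smulRight (ν i x))

/-- Evaluation of `tubeMapDeriv`. [folklore] -/
@[simp] lemma tubeMapDeriv_apply (ν : ι → P → Q) (f' : P →L[ℝ] Q) (ν' : ι → P →L[ℝ] Q) (x : P)
    (s : ι → ℝ) (v : P) (σ : ι → ℝ) :
    tubeMapDeriv ν f' ν' x s (v, σ) = f' v + ∑ i, (s i • ν' i v + σ i • ν i x) := by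
  simp [tubeMapDeriv]

/-- At the zero section the derivative is `(v, σ) ↦ f′ v + ∑ σᵢ νᵢ x`. [folklore] -/
lemma tubeMapDeriv_zero_apply (ν : ι → P → Q) (f' : P →L[ℝ] Q) (ν' : ι → P →L[ℝ] Q) (x : P)
    (v : P) (σ : ι → ℝ) :
    tubeMapDeriv ν f' ν' x 0 (v, σ) = f' v + ∑ i, σ i • ν i x := by
  simp [tubeMapDeriv_apply]

/-- **The derivative of the tube map within `C ×ˢ univ`** from derivatives of `f`, `νᵢ` within
`C`. [folklore] -/
theorem hasFDerivWithinAt_tubeMap {C : Set P} {f : P → Q} {ν : ι → P → Q} {f' : P → P →L[ℝ] Q}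
    {ν' : ι → P → P →L[ℝ] Q} {x : P} (s : ι → ℝ)
    (hf : HasFDerivWithinAt f (f' x) C x) (hν : ∀ i, HasFDerivWithinAt (ν i) (ν' i x) C x) :
    HasFDerivWithinAt (tubeMap f ν) (tubeMapDeriv ν (f' x) (fun i => ν' i x) x s)
      (C ×ˢ (univ : Set (ι → ℝ))) (x, s) := by
  have hfst : HasFDerivWithinAt (fun p : P × (ι → ℝ) => p.1) (ContinuousLinearMap.fst ℝ P (ι → ℝ))
      (C ×ˢ (univ : Set (ι → ℝ))) (x, s) := hasFDerivWithinAt_fst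
  have hmaps : MapsTo (fun p : P × (ι → ℝ) => p.1) (C ×ˢ (univ : Set (ι → ℝ))) C :=
    fun p hp => hp.1
  have hf' : HasFDerivWithinAt (fun p : P × (ι → ℝ) => f p.1)
      ((f' x).comp (ContinuousLinearMap.fst ℝ P (ι → ℝ))) (C ×ˢ (univ : Set (ι → ℝ))) (x, s) :=
    hf.comp (x, s) hfst hmaps
  have hν' : ∀ i, HasFDerivWithinAt (fun p : P × (ι → ℝ) => ν i p.1)
      ((ν' i x).comp (ContinuousLinearMap.fst ℝ P (ι → ℝ))) (C ×ˢ (univ : Set (ι → ℝ))) (x, s) :=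
    fun i => (hν i).comp (x, s) hfst hmaps
  have hcoord : ∀ i, HasFDerivWithinAt (fun p : P × (ι → ℝ) => p.2 i)
      ((ContinuousLinearMap.proj i).comp (ContinuousLinearMap.snd ℝ P (ι → ℝ)))
      (C ×ˢ (univ : Set (ι → ℝ))) (x, s) :=
    fun i => (((ContinuousLinearMap.proj i).comp
      (ContinuousLinearMap.snd ℝ P (ι → ℝ))).hasFDerivAt).hasFDerivWithinAt
  have hterm : ∀ i, HasFDerivWithinAt (fun p : P × (ι → ℝ) => p.2 i • ν i p.1)
      (s i • (ν' i x).comp (ContinuousLinearMap.fst ℝ P (ι → ℝ)) +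
        ((ContinuousLinearMap.proj i).comp (ContinuousLinearMap.snd ℝ P (ι → ℝ))).smulRight (ν i x))
      (C ×ˢ (univ : Set (ι → ℝ))) (x, s) :=
    fun i => (hcoord i).smul (hν' i)
  have hsum := HasFDerivWithinAt.sum (u := Finset.univ) fun i _ => hterm i
  have hsum' : HasFDerivWithinAt (fun p : P × (ι → ℝ) => ∑ i, p.2 i • ν i p.1)
      (∑ i, (s i • (ν' i x).comp (ContinuousLinearMap.fst ℝ P (ι → ℝ)) +
        ((ContinuousLinearMap.proj i).comp (ContinuousLinearMap.snd ℝ P (ι → ℝ))).smulRight (ν i x)))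
      (C ×ˢ (univ : Set (ι → ℝ))) (x, s) := by
    have e : (fun p : P × (ι → ℝ) => ∑ i, p.2 i • ν i p.1) =
        ∑ i, (fun p : P × (ι → ℝ) => p.2 i • ν i p.1) := by
      funext p; simp only [Finset.sum_apply]
    rw [e]; exact hsum
  exact hf'.add hsum'

/-- **Continuity of the derivative of the tube map** on `C ×ˢ univ` when `f′`, `νᵢ`, `νᵢ′` are
continuous on `C`. [folklore] -/
theorem continuousOn_tubeMapDeriv {C : Set P} {ν : ι → P → Q} {f' : P → P →L[ℝ] Q}
    {ν' : ι → P → P →L[ℝ] Q} (hf' : ContinuousOn f' C) (hν : ∀ i, ContinuousOn (ν i) C)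
    (hν' : ∀ i, ContinuousOn (ν' i) C) :
    ContinuousOn (fun p : P × (ι → ℝ) => tubeMapDeriv ν (f' p.1) (fun i => ν' i p.1) p.1 p.2)
      (C ×ˢ (univ : Set (ι → ℝ))) := by
  have hfst : ContinuousOn (fun p : P × (ι → ℝ) => p.1) (C ×ˢ (univ : Set (ι → ℝ))) :=
    continuous_fst.continuousOn
  have hmaps : MapsTo (fun p : P × (ι → ℝ) => p.1) (C ×ˢ (univ : Set (ι → ℝ))) C :=
    fun p hp => hp.1
  -- `L ↦ L.comp fst` is a continuous linear map
  have hcompfst : Continuous fun L : P →L[ℝ] Q => L.comp (ContinuousLinearMap.fst ℝ P (ι → ℝ)) :=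
    ((ContinuousLinearMap.compL ℝ (P × (ι → ℝ)) P Q).flip
      (ContinuousLinearMap.fst ℝ P (ι → ℝ))).continuous
  unfold tubeMapDeriv
  refine ContinuousOn.add (hcompfst.comp_continuousOn (hf'.comp hfst hmaps)) ?_
  refine continuousOn_finsetSum _ fun i _ => ContinuousOn.add ?_ ?_
  · exact ((continuous_apply i).comp_continuousOn continuous_snd.continuousOn).smul
      (hcompfst.comp_continuousOn ((hν' i).comp hfst hmaps))
  · exact (ContinuousLinearMap.smulRightL ℝ (P × (ι → ℝ)) Q ((ContinuousLinearMap.proj i).comp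
      (ContinuousLinearMap.snd ℝ P (ι → ℝ)))).continuous.comp_continuousOn ((hν i).comp hfst hmaps)

/-! ### Local injectivity of the tube map, also at boundary points -/

/-- **Local injectivity of the tube map** (Hirsch 1976, Ch. 4 Thm. 5.1 / §6 for ∂-manifolds): let
`C` be convex (e.g. a half ball in a boundary chart), `f, νᵢ` be `C¹` on `C` in the sense of
derivatives `f′`, `νᵢ′` within `C` which are continuous on `C`, with `νᵢ` continuous on `C`, and
suppose the frame is transverse at `x₀ ∈ C`: `c ‖(v, σ)‖ ≤ ‖f′(x₀) v + ∑ σᵢ νᵢ(x₀)‖`, `c > 0`.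
Then the tube map is injective on `(C ∩ B(x₀, r)) × B(0, r)` for some `r > 0`. [cite: Hirsch1976, Ch. 4 Thm. 5.1] -/
theorem exists_injOn_tubeMap {C : Set P} (hC : Convex ℝ C) {f : P → Q} {ν : ι → P → Q}
    {f' : P → P →L[ℝ] Q} {ν' : ι → P → P →L[ℝ] Q}
    (hf : ∀ x ∈ C, HasFDerivWithinAt f (f' x) C x)
    (hν : ∀ i, ∀ x ∈ C, HasFDerivWithinAt (ν i) (ν' i x) C x)
    (hf'c : ContinuousOn f' C) (hνc : ∀ i, ContinuousOn (ν i) C) (hν'c : ∀ i, ContinuousOn (ν' i) C)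
    {x₀ : P} (hx₀ : x₀ ∈ C) {c : ℝ} (hc : 0 < c)
    (hbelow : ∀ (v : P) (σ : ι → ℝ), c * ‖(v, σ)‖ ≤ ‖f' x₀ v + ∑ i, σ i • ν i x₀‖) :
    ∃ r > 0, InjOn (tubeMap f ν) ((C ∩ ball x₀ r) ×ˢ ball (0 : ι → ℝ) r) := by
  set K : Set (P × (ι → ℝ)) := C ×ˢ (univ : Set (ι → ℝ)) with hK
  have hKc : Convex ℝ K := hC.prod convex_univ
  have hp₀ : ((x₀, 0) : P × (ι → ℝ)) ∈ K := ⟨hx₀, mem_univ _⟩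
  set G' : P × (ι → ℝ) → P × (ι → ℝ) →L[ℝ] Q :=
    fun p => tubeMapDeriv ν (f' p.1) (fun i => ν' i p.1) p.1 p.2 with hG'
  have hG : ∀ p ∈ K, HasFDerivWithinAt (tubeMap f ν) (G' p) K p := by
    rintro ⟨x, s⟩ ⟨hx, -⟩
    exact hasFDerivWithinAt_tubeMap s (hf x hx) (fun i => hν i x hx)
  have hcont : ContinuousWithinAt G' K (x₀, 0) :=
    (continuousOn_tubeMapDeriv hf'c hνc hν'c) _ hp₀
  have hbelow' : ∀ v : P × (ι → ℝ), c * ‖v‖ ≤ ‖G' (x₀, 0) v‖ := by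
    rintro ⟨v, σ⟩
    rw [hG']
    change c * ‖(v, σ)‖ ≤ ‖tubeMapDeriv ν (f' x₀) (fun i => ν' i x₀) x₀ 0 (v, σ)‖
    rw [tubeMapDeriv_zero_apply]
    exact hbelow v σ
  obtain ⟨r, hr, hinj⟩ := injOn_of_hasFDerivWithinAt_of_antilipschitz hKc hG hcont hc hbelow'
  refine ⟨r, hr, fun p hp q hq hpq => hinj ⟨⟨hp.1.1, mem_univ _⟩, ?_⟩ ⟨⟨hq.1.1, mem_univ _⟩, ?_⟩ hpq⟩
  · rw [mem_ball, Prod.dist_eq, max_lt_iff]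
    exact ⟨hp.1.2, by simpa using hp.2⟩
  · rw [mem_ball, Prod.dist_eq, max_lt_iff]
    exact ⟨hq.1.2, by simpa using hq.2⟩

/-! ### Openness at interior points -/

/-- **The tube map is open at interior points** (inverse function theorem): if `f`, `νᵢ` are `C¹`
at `x` (an interior point of the chart image) and the derivative
`(v, σ) ↦ f′(x) v + ∑ (sᵢ • νᵢ′(x) v + σᵢ • νᵢ x)` is injective, the tube map sends
neighbourhoods of `(x, s)` onto neighbourhoods of its value (finite equal dimensions).
[cite: Hirsch1976, Ch. 4 Thm. 5.1] -/
theorem map_nhds_tubeMap_eq [FiniteDimensional ℝ P] [FiniteDimensional ℝ Q] {f : P → Q}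
    {ν : ι → P → Q} {x : P} (s : ι → ℝ) (hf : ContDiffAt ℝ 1 f x)
    (hν : ∀ i, ContDiffAt ℝ 1 (ν i) x)
    (hdim : Module.finrank ℝ P + Fintype.card ι = Module.finrank ℝ Q)
    (hinj : Function.Injective
      (tubeMapDeriv ν (fderiv ℝ f x) (fun i => fderiv ℝ (ν i) x) x s)) :
    map (tubeMap f ν) (𝓝 (x, s)) = 𝓝 (tubeMap f ν (x, s)) := by
  -- the tube map is `C¹` at `(x, s)` with the stated derivative
  have hcd : ContDiffAt ℝ 1 (tubeMap f ν) (x, s) := by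
    unfold tubeMap
    refine (hf.comp _ contDiffAt_fst).add ?_
    refine ContDiffAt.sum fun i _ => ?_
    exact (((ContinuousLinearMap.proj i : (ι → ℝ) →L[ℝ] ℝ).contDiff.contDiffAt).comp _
      contDiffAt_snd).smul ((hν i).comp _ contDiffAt_fst)
  have hderiv : HasFDerivAt (tubeMap f ν)
      (tubeMapDeriv ν (fderiv ℝ f x) (fun i => fderiv ℝ (ν i) x) x s) (x, s) := by
    have h := hasFDerivWithinAt_tubeMap (C := univ) (f := f) (ν := ν) (f' := fun y => fderiv ℝ f y)
      (ν' := fun i y => fderiv ℝ (ν i) y) s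
      (hf.differentiableAt one_ne_zero).hasFDerivAt.hasFDerivWithinAt
      (fun i => ((hν i).differentiableAt one_ne_zero).hasFDerivAt.hasFDerivWithinAt)
    rw [univ_prod_univ] at h
    exact h.hasFDerivAt_of_univ
  have hstrict : HasStrictFDerivAt (tubeMap f ν)
      (tubeMapDeriv ν (fderiv ℝ f x) (fun i => fderiv ℝ (ν i) x) x s) (x, s) := by
    have := hcd.hasStrictFDerivAt one_ne_zero
    rwa [hderiv.fderiv] at this
  -- the derivative is a linear equivalence (injective between spaces of equal finite dimension)
  have hdim' : Module.finrank ℝ (P × (ι → ℝ)) = Module.finrank ℝ Q := by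
    rw [Module.finrank_prod, Module.finrank_fintype_fun_eq_card, hdim]
  set L := tubeMapDeriv ν (fderiv ℝ f x) (fun i => fderiv ℝ (ν i) x) x s with hL
  have hsurj : Function.Surjective L :=
    (LinearMap.injective_iff_surjective_of_finrank_eq_finrank hdim').1 hinj
  exact hstrict.map_nhds_eq_of_surj (LinearMap.range_eq_top.2 hsurj)

end AffineTube

end Literature.Topology.FourManifolds
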